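import Literature.MathematicalPhysics.QuantumFieldTheory.Balaban1983to89.B1TorusCubeDeriv

/-!
# `Balaban1983to89.B1TorusCubeDerivInput` — [Balaban1983RegularityDecay] LEMMA 2.2 (2.17), DERIVATIVE MEMBER «‖D^η_{A,μ}G_k(□,A)f‖_∞ ≤ c₂‖f‖_∞»,
# READ ON THE CUBES `□_j` OF THE (Higgs)₂,₃ TORUS AT THE CUBE CONFIGURATION `Ã_j`: the per-cube derivative input of the torus walk —
# `‖D^ε_{Ã_j}G_j(h_jψ)(b)‖ ≤ C_δ(L^Kε)‖ψ‖_∞` on the bonds of `□_j` — from the lineage's `B4Lemma22CrossSup.lemma22_17_sup_box` through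
# gen 8's cube chart (`B1TorusCubeBoxOp`) and this seat's bond dictionary (`B1TorusCubeDeriv`)

statement-level skeleton of published theorems with citation tags; proofs where landed; nothing here is a claim about the Yang–Mills mass gap

CITATION HEADER (lean-in-tree rule).  T. Bałaban, *Regularity and decay of lattice Green's functions*, Commun. Math. Phys. **89** (1983)
571–597 [Balaban1983RegularityDecay] (Lemma 2.2 (2.17) p. 578; §2 p. 575 `Ã_j`; Theorem (1.10) p. 573 «for e sufficiently small») and
T. Bałaban, *(Higgs)₂,₃ quantum fields in a finite volume. I*, Commun. Math. Phys. **85** (1982) 603–626 [Balaban1982Higgs1] (Prop. 2.1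
(2.23)–(2.25) pp. 610–611).  Cell `lit-balaban` (HOME `run/shared/lean/pub/lit-balaban/`), Phase-2 proof seat **p35** gen 9 (unit
`lit-balaban-p35`); SKELETON rows **B4.Lem2.2** ((2.17) derivative member ON THE TORUS CUBES), **B4.Thm@573**, **B1.Prop2.1**.  USED BY
NAME, never restated: everything of gen 8's `B1TorusCubeBoxOp.cube_inputs` (the same «e sufficiently small» plumbing — flow `e^{tq}`,
`cubeField_hyps`, `cubeField_threshold`, `opA_isUnit_det`, `hsize_hBox`, `pull_propagatorK`), r01/p17/p38's `lemma22_17_sup_box`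
(whose SECOND conclusion is the derivative member), `B4CubeFieldHyps22.derivA_smul`, this seat's `B1TorusCubeDeriv.smul_ofLp_covDeriv_toT`.

WHAT IS PRINTED (p. 578).  *«Lemma 2.2. … Then for e sufficiently small … a constant c₂ depending on d, p₁, such that ‖G_k(□,A)f‖_q,
‖D^η_{A,μ}G_k(□,A)f‖_q, ‖G_k(□,A)D^{η*}_{A,μ}f‖_q ≤ c₂‖f‖_p (2.17) for 1 ≤ p, q ≤ ∞ …»*; p. 578: *«These two lemmas together with
the representation (2.13) imply the theorem.»*

WHAT THIS FILE PROVES (kernel-checked, zero `sorry`, theorems only; axioms standard).  **`cube_input_deriv`** — with the quantifier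
order of `B1TorusCubeBoxOp.cube_inputs` (a constant `C_δ > 0` from Lemma 2.2 at charge 1; for `(creg, β, K₀ ≥ 8)` a threshold `e₁`;
then the instance: torus, `a ∈ [a₋, a₊]`, `m² > 0` with `m²(L^Kε)² ≤ m²₊`, label `j`, ANY `A` whose scaled components `acT` are
(1.7)-regular on the box, `0 < e_c ≤ e₁`): for every `ψ` and every bond `⟨x, x + εe_μ⟩` with both ends in `□_j`,
`‖D^ε_{Ã_j}G_j(h_jψ)(⟨x, μ⟩)‖ ≤ C_δ·(L^Kε)·‖ψ‖_∞` (`C_δ = (1 + ℓ₁)·2(d+2)c₂`; the factor `L^Kε = (L^Kε)²·(L^Kε)⁻¹` is the model's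
scaling of (2.25)).  HONEST SCOPE: as `cube_inputs` (cubes of the (Higgs)₂,₃ torus, `K₀ ≥ 8`, `3M ≤ |T_ε|_μ`, `L ≥ 2`); bonds
straddling `∂□_j` are excluded (Neumann data; they do not meet `supp h_j`).  Unit `lit-balaban-p35` gen 9 (literature-prover-lit-balaban-p35-g9-0).
-/

open scoped BigOperators Matrix

noncomputable section

namespace Literature.MathematicalPhysics.QuantumFieldTheory.Balaban1983to89.B1TorusCubeDerivInput

open Matrix (toEuclideanCLM)
open Literature.MathematicalPhysics.QuantumFieldTheory.Balaban1983to89.HiggsLattice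
open Literature.MathematicalPhysics.QuantumFieldTheory.Balaban1983to89.HiggsAveraging
open Literature.MathematicalPhysics.QuantumFieldTheory.Balaban1983to89.HiggsCovariance
open Literature.MathematicalPhysics.QuantumFieldTheory.Balaban1983to89.HiggsCovariancePos
  (shift_unshift unshift_shift isUnit_covOpK covOpK_mul_propagatorK covOpK_propagatorK_apply)
open Literature.MathematicalPhysics.QuantumFieldTheory.Balaban1983to89.B1TorusCubeCover
open Literature.MathematicalPhysics.QuantumFieldTheory.Balaban1983to89.B1TorusCubeLocality26
open Literature.MathematicalPhysics.QuantumFieldTheory.Balaban1983to89.B1TorusCubeChart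
open Literature.MathematicalPhysics.QuantumFieldTheory.Balaban1983to89.B1TorusCubeContours
open Literature.MathematicalPhysics.QuantumFieldTheory.Balaban1983to89.B4GaugeCovariance
open Literature.MathematicalPhysics.QuantumFieldTheory.Balaban1983to89.B4Commutators25to211 (mulH fld_mulH_mulVec)
open Literature.MathematicalPhysics.QuantumFieldTheory.Balaban1983to89.B4Reflection242 (boxDom mem_boxDom blk nbrs mem_nbrs
  nbrs_comm blk_mem_boxDom)
open Literature.MathematicalPhysics.QuantumFieldTheory.Balaban1983to89.B4Lower18Regular (e1 e1_apply_self e1_apply_ne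
  lsum PathRel baseEmb abs_lsum_le blkWt_ne_zero)
open Literature.MathematicalPhysics.QuantumFieldTheory.Balaban1983to89.B4Lower18RegularRegion (compField compField_add e1_inj)
open Literature.MathematicalPhysics.QuantumFieldTheory.Balaban1983to89.B4Lemma21Region (siteNorm)
open Literature.MathematicalPhysics.QuantumFieldTheory.Balaban1983to89.B4Lemma22Reduce231 (supN le_supN supN_le supN_nonneg
  siteNorm_nonneg)
open Literature.MathematicalPhysics.QuantumFieldTheory.Balaban1983to89.B4Lemma22PertVSup (contourTrans_fieldLink
  fld_avgOp_transpose_mulVec supN_neg supN_smul_le)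
open Literature.MathematicalPhysics.QuantumFieldTheory.Balaban1983to89.B4Lemma22ReduceZero (Box opA greenA derivA)
open Literature.MathematicalPhysics.QuantumFieldTheory.Balaban1983to89.B4Lemma22Invertible (opA_isUnit_det greenA_mul_opA)
open Literature.MathematicalPhysics.QuantumFieldTheory.Balaban1983to89.B4Eq12ExpFlow (expFlow expFlow_U expFlow_lipschitz)
open Literature.MathematicalPhysics.QuantumFieldTheory.Balaban1983to89.B4PartitionUnity22 (hprof thetaProf hCube thetaCube D1 D2
  D1_nonneg D2_nonneg contDiff_hprof hasCompactSupport_hprof contDiff_thetaProf hasCompactSupport_thetaProf)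
open Literature.MathematicalPhysics.QuantumFieldTheory.Balaban1983to89.B4Eq220PartitionSizes (hZ hBox hsize_hBox)
open Literature.MathematicalPhysics.QuantumFieldTheory.Balaban1983to89.B4CubeFields22 (thetaZ cubeField cubeFluct cubeField_step
  cubeField_antisymm)
open Literature.MathematicalPhysics.QuantumFieldTheory.Balaban1983to89.B4CubeFieldHyps22 (cubeField_hyps cubeField_threshold
  aSeq_window kOp_smul greenA_smul smul_cubeField derivA_smul)
open Literature.MathematicalPhysics.QuantumFieldTheory.Balaban1983to89.B4Eq220CommutatorField (kOp kOp_eq_opA supN_mulH_le)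
open Literature.MathematicalPhysics.QuantumFieldTheory.Balaban1983to89.B4Eq220FactorField (eq220_sup_box)
open Literature.MathematicalPhysics.QuantumFieldTheory.Balaban1983to89.B4Lemma22CrossSup (lemma22_17_sup_box)

open Literature.MathematicalPhysics.QuantumFieldTheory.Balaban1983to89.B1TorusCubeBoxOp
open Literature.MathematicalPhysics.QuantumFieldTheory.Balaban1983to89.B1TorusCubeDeriv (smul_ofLp_covDeriv_toT)
open Literature.MathematicalPhysics.QuantumFieldTheory.Balaban1983to89.B4Lemma22Reduce231 (siteNorm_smul)

variable {P : HiggsLattice.Params} {N : ℕ}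

/-- The Euclidean site norm of the coordinate vector of `v ∈ ℝ^N` is `‖v‖`. [folklore] -/
private theorem siteNorm_ofLp (v : EuclideanSpace ℝ (Fin N)) : siteNorm (WithLp.ofLp v) = ‖v‖ := by
  rw [siteNorm, EuclideanSpace.norm_eq]
  congr 1
  simp only [dotProduct, Real.norm_eq_abs, sq, abs_mul_abs_self]

section Inputs

variable {K K₀ : ℕ}

set_option maxHeartbeats 800000 in
/-- **THE PER-CUBE DERIVATIVE INPUT OF THE TORUS RANDOM WALK FROM THE LINEAGE'S LEMMA 2.2, (2.17) DERIVATIVE MEMBER**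
«‖D^η_{A,μ}G_k(□_j,Ã_j)h_jψ‖_∞ ≤ c₂O(1)‖ψ‖_∞» (in the model's units `O(1)(L^Kε)`), ON THE CUBES OF THE (Higgs)₂,₃ TORUS, with only
«e sufficiently small» — quantifier order as in `B1TorusCubeBoxOp.cube_inputs`; conclusion on every bond `⟨x, x + εe_μ⟩ ⊂ □_j`.
[cite: Balaban1983RegularityDecay, Lemma 2.2 (2.17) p.578, Theorem p.573 «for e sufficiently small»]
[cite: Balaban1982Higgs1, Prop. 2.1 (2.23)–(2.25) pp.610–611] -/
theorem cube_input_deriv (C : ChargeData N) (d0 ℓ0 : ℕ) (hℓ0 : 1 ≤ ℓ0) (amin aplus m2plus : ℝ) (ha : 0 < amin) :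
    ∃ Cδ : ℝ, 0 < Cδ ∧ ∀ (creg β : ℝ), 0 ≤ creg → 0 < β → ∀ (K₀ : ℕ), 8 ≤ K₀ →
      ∃ e₁ : ℝ, 0 < e₁ ∧ ∀ (P : HiggsLattice.Params), dd P = d0 → P.L - 1 = ℓ0 →
        ∀ (K : ℕ), 1 ≤ K → K ≤ P.K → K₀ ∣ P.M → (∀ μ, 3 * half P K K₀ ≤ P.sitesPerDir 0 μ) →
        ∀ (a msq : ℝ), amin ≤ a → a ≤ aplus → 0 < msq → msq * P.mesh K ^ 2 ≤ m2plus →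
        ∀ (j : Lab P K K₀) (A : HiggsLattice.VecField P 0) (ec : ℝ), 0 < ec → ec ≤ e₁ →
          (∀ y ∈ Box (dd P) (P.L - 1) K (M2 P K₀), ∀ i i' : Fin (dd P + 1),
            |acT K K₀ j ((((P.L - 1 + 1) ^ K : ℕ) : ℝ) * P.mesh 0 * C.e / ec) A (y + e1 i) i'
              - acT K K₀ j ((((P.L - 1 + 1) ^ K : ℕ) : ℝ) * P.mesh 0 * C.e / ec) A y i'|
              ≤ creg * ec ^ (β - 1) / ((P.L - 1 + 1) ^ K : ℕ)) →
          ∀ (ψ : HiggsLattice.ScalarField P 0 N) (x : HiggsLattice.Site P 0) (μ : Fin P.d),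
            x ∈ cube K K₀ j → x.shift μ ∈ cube K K₀ j →
            ‖covDeriv C (cubeVec K K₀ j A) (propagatorK C (cube K K₀ j) (cubeVec K K₀ j A) msq a K (hTor K K₀ j • ψ)) ⟨x, μ⟩‖
              ≤ Cδ * P.mesh K * ‖ψ‖ := by
  classical
  -- the constants of Lemma 2.2 at charge 1, generic contour systems
  obtain ⟨c', hc', hLγ⟩ := lemma22_17_sup_box (flowC C) (ellC_nonneg C) (flowC_lipschitz C) 1 d0 ℓ0 hℓ0 amin aplus m2plus ha
  by_cases hapl : aplus < amin
  · refine ⟨1, one_pos, fun creg β _ _ K₀ _ => ⟨1, one_pos, ?_⟩⟩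
    intro P _ _ K _ _ _ _ a msq e1' e2
    exact absurd (e1'.trans e2) (not_le.2 hapl)
  rw [not_lt] at hapl
  have hapl0 : 0 ≤ aplus := ha.le.trans hapl
  have hℓ₁ : 0 ≤ ellC C := ellC_nonneg C
  set Cδ : ℝ := (1 + ellC C) * (2 * (((d0 : ℝ) + 2) * c')) with hCδ_def
  have hCδ0 : 0 < Cδ := by positivity
  refine ⟨Cδ, hCδ0, fun creg β hcreg hβ K₀ hK₀8 => ?_⟩
  obtain ⟨e₁, he₁, hth⟩ := cubeField_threshold d0 (aplus := aplus) hℓ₁ hc'.le ha hcreg hβ (2 * K₀) K₀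
  refine ⟨e₁, he₁, ?_⟩
  intro P hd hl K hK1 hK hK₀ hN3 a msq e1' e2 hmsq e4 j A ec hec hle h17
  subst hd; subst hl
  -- the instance
  have hK₀' : 1 ≤ K₀ := le_trans (by norm_num) hK₀8
  have hℓ : 1 ≤ P.L - 1 := hℓ0
  have hL2 : 2 ≤ P.L := by omega
  have hn : 1 ≤ (P.L - 1 + 1) ^ K := one_le_n P K
  have hn2 : 2 ≤ (P.L - 1 + 1) ^ K := by
    calc 2 ≤ P.L - 1 + 1 := by omega
      _ = (P.L - 1 + 1) ^ 1 := (pow_one _).symm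
      _ ≤ (P.L - 1 + 1) ^ K := Nat.pow_le_pow_right (by omega) hK1
  have hnK : 16 ≤ (P.L - 1 + 1) ^ K * K₀ := by nlinarith
  have hnK3 : 3 ≤ (P.L - 1 + 1) ^ K * K₀ := le_trans (by norm_num) hnK
  have hnr : (0 : ℝ) < (((P.L - 1 + 1) ^ K : ℕ) : ℝ) := by exact_mod_cast hn
  have hM : ∀ i, 1 ≤ M2 P K₀ i := fun i => by unfold M2; omega
  have hS : ∀ i, M2 P K₀ i ≤ 2 * K₀ := fun i => le_rfl
  have hKM : ∀ μ, K₀ ∣ M2 P K₀ μ := fun μ => ⟨2, by unfold M2; ring⟩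
  have hjlo : ∀ μ : Fin (dd P + 1), (1 : ℤ) ≤ (fun _ : Fin (dd P + 1) => (1 : ℤ)) μ := fun μ => le_rfl
  have hjhi : ∀ μ : Fin (dd P + 1), (K₀ : ℤ) * ((fun _ : Fin (dd P + 1) => (1 : ℤ)) μ + 1) ≤ M2 P K₀ μ := by
    intro μ; unfold M2; push_cast; linarith
  have ha' : 0 < a := lt_of_lt_of_le ha e1'
  have hm2 : 0 ≤ msq * P.mesh K ^ 2 := by positivity
  have hmeshK : 0 < P.mesh K := by unfold HiggsLattice.Params.mesh; have := P.hε; have := P.hL; positivity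
  obtain ⟨hak1, hak2⟩ := aSeq_window hℓ hK1 ha e1' e2
  have hak0 : 0 ≤ B1.aSeq a (((P.L - 1 : ℕ) : ℝ) + 1) K := by linarith
  have hakP : 0 ≤ B1.aSeq a P.L K := aSeq_nonneg_model hL2 ha' hK1
  -- the scaled field and the coupling `κ = e_c/n`, `κσ = εe`
  set σ : ℝ := (((P.L - 1 + 1) ^ K : ℕ) : ℝ) * P.mesh 0 * C.e / ec with hσ
  have hκσ : ec / (((P.L - 1 + 1) ^ K : ℕ) : ℝ) * σ = P.mesh 0 * C.e := by
    rw [hσ]; field_simp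
  obtain ⟨hθ1, hsm2, hsm⟩ := hth ec hec hle _ hak1 hak2
  obtain ⟨hanti', hA', hder, hbd⟩ :=
    cubeField_hyps (d := dd P) hn hS hK₀' hnK hjlo hjhi hcreg hec h17 (β := β)
  -- contour-system facts for the lineage
  have hend' : ∀ y x, blkWt ((P.L - 1 + 1) ^ K) (M2 P K₀) (fun i => (P.L - 1 + 1) ^ K * M2 P K₀ i) y x ≠ 0 →
      pathEnd (baseEmb (one_le_n P K) (M2 P K₀) y) (gammaT P K K₀ y x) = x := fun y x h => gammaT_hend y x h
  have hnn' : ∀ y x, blkWt ((P.L - 1 + 1) ^ K) (M2 P K₀) (fun i => (P.L - 1 + 1) ^ K * M2 P K₀ i) y x ≠ 0 →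
      PathRel (fun u v : ↥(Box (dd P) (P.L - 1) K (M2 P K₀)) => v.1 ∈ nbrs u.1)
        (baseEmb (one_le_n P K) (M2 P K₀) y) (gammaT P K K₀ y x) := fun y x _ => gammaT_nn y x
  -- the quantities θ, θ', τ of the lineage
  set θ : ℝ := ((dd P : ℝ) + 1) * ((2 * K₀ : ℕ) : ℝ) * creg * ec ^ β with hθ_def
  set θ' : ℝ := creg * ec ^ β * (1 + D1 thetaProf * (((dd P : ℝ) + 1) * ((2 * K₀ : ℕ) : ℝ)) / K₀) with hθ'_def
  have hθ0 : 0 ≤ θ := by have := (Real.rpow_pos_of_pos hec β).le; positivity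
  have hθ'0 : 0 ≤ θ' := by
    have := (Real.rpow_pos_of_pos hec β).le
    have := D1_nonneg contDiff_thetaProf hasCompactSupport_thetaProf
    positivity
  set A₀' : Fin (dd P + 1) → ℝ := fun μ => ec / (((P.L - 1 + 1) ^ K : ℕ) : ℝ) * acT K K₀ j σ A 0 μ with hA₀'
  set A' : ↥(Box (dd P) (P.L - 1) K (M2 P K₀)) → ↥(Box (dd P) (P.L - 1) K (M2 P K₀)) → ℝ := fun u v =>
    ec / (((P.L - 1 + 1) ^ K : ℕ) : ℝ) * cubeFluct (Box (dd P) (P.L - 1) K (M2 P K₀)) ((P.L - 1 + 1) ^ K) K₀ (fun _ => 1)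
      (acT K K₀ j σ A 0) (acT K K₀ j σ A) u v with hA'_def
  have hfield : (fun u v => ec / (((P.L - 1 + 1) ^ K : ℕ) : ℝ) * boxField K K₀ j σ A u v)
      = constBond A₀' Subtype.val + A' :=
    smul_cubeField _ _ _ _ _ _
  have hunit : IsUnit (opA (dd P) (flowC C) 1 (P.L - 1) K a (msq * P.mesh K ^ 2) (M2 P K₀)
      (baseEmb (one_le_n P K) (M2 P K₀)) (gammaT P K K₀) (constBond A₀' Subtype.val + A')).det :=
    opA_isUnit_det (flowC C) 1 hℓ hK1 ha' hm2 (M2 P K₀) hnn' hend' _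
  have hτ : ∀ y x, blkWt ((P.L - 1 + 1) ^ K) (M2 P K₀) (fun i => (P.L - 1 + 1) ^ K * M2 P K₀ i) y x ≠ 0 →
      |1 * lsum A' (baseEmb (one_le_n P K) (M2 P K₀) y) (gammaT P K K₀ y x)| ≤ ((dd P : ℝ) + 1) * θ := by
    intro y x _
    have h1 := abs_lsum_le (r := fun u v : ↥(Box (dd P) (P.L - 1) K (M2 P K₀)) => v.1 ∈ nbrs u.1) (κ := 1) (B := A')
      (ρ := θ / ((P.L - 1 + 1) ^ K : ℕ)) (fun u v huv => hA' u v huv) _ _ (gammaT_nn y x)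
    have hlen := length_gammaT_le y x
    have hlenR : ((gammaT P K K₀ y x).length : ℝ) ≤ ((dd P : ℝ) + 1) * ((((P.L - 1 + 1) ^ K : ℕ) : ℝ) - 1) := by
      rw [predL_succ]
      have : (((gammaT P K K₀ y x).length : ℤ) : ℝ) ≤ ((((dd P : ℤ) + 1) * ((P.L : ℤ) ^ K - 1) : ℤ) : ℝ) := by
        exact_mod_cast hlen
      push_cast at this ⊢
      exact this
    refine h1.trans ?_
    rw [div_eq_mul_inv]
    have hθn : 0 ≤ θ * ((((P.L - 1 + 1) ^ K : ℕ) : ℝ))⁻¹ := by positivity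
    calc ((gammaT P K K₀ y x).length : ℝ) * (θ * ((((P.L - 1 + 1) ^ K : ℕ) : ℝ))⁻¹)
        ≤ ((dd P : ℝ) + 1) * ((((P.L - 1 + 1) ^ K : ℕ) : ℝ) - 1) * (θ * ((((P.L - 1 + 1) ^ K : ℕ) : ℝ))⁻¹) :=
          mul_le_mul_of_nonneg_right hlenR hθn
      _ = ((dd P : ℝ) + 1) * θ * (((((P.L - 1 + 1) ^ K : ℕ) : ℝ) - 1) * ((((P.L - 1 + 1) ^ K : ℕ) : ℝ))⁻¹) := by ring
      _ ≤ ((dd P : ℝ) + 1) * θ * 1 := by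
          refine mul_le_mul_of_nonneg_left ?_ (by positivity)
          rw [← div_eq_mul_inv, div_le_one hnr]; linarith
      _ = ((dd P : ℝ) + 1) * θ := mul_one _
  have hτ0 : 0 ≤ ((dd P : ℝ) + 1) * θ := by positivity
  -- the two smallness conditions (for `c` and for `c'`) from the common threshold at `max c c'`
  have hsmγ : ((dd P : ℝ) + 2) * c' * (((dd P : ℝ) + 1) * ellC C * (θ + θ') + ((dd P : ℝ) + 1) * ellC C * θ
      + ((dd P : ℝ) + 1) * ellC C ^ 2 * θ ^ 2
      + B1.aSeq a (((P.L - 1 : ℕ) : ℝ) + 1) K * (ellC C * (((dd P : ℝ) + 1) * θ) * (2 + ellC C * (((dd P : ℝ) + 1) * θ))))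
      ≤ 1 / 2 := hsm
  have hHS := hsize_hBox (d := dd P) hn hK₀' hnK3 hKM (fun _ : Fin (dd P + 1) => (1 : ℤ))
  -- the conversion `κ = e_c/n ↦ κ = 1`
  have hconvG : greenA (dd P) (flowC C) (ec / (((P.L - 1 + 1) ^ K : ℕ) : ℝ)) (P.L - 1) K a (msq * P.mesh K ^ 2) (M2 P K₀)
      (baseEmb (one_le_n P K) (M2 P K₀)) (gammaT P K K₀) (boxField K K₀ j σ A)
      = greenA (dd P) (flowC C) 1 (P.L - 1) K a (msq * P.mesh K ^ 2) (M2 P K₀)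
        (baseEmb (one_le_n P K) (M2 P K₀)) (gammaT P K K₀) (constBond A₀' Subtype.val + A') := by
    rw [greenA_smul, hfield]
  -- the derivative conversion `κ = e_c/n ↦ κ = 1`
  have hconvD : ∀ i : Fin (dd P + 1), derivA (dd P) (flowC C) (ec / (((P.L - 1 + 1) ^ K : ℕ) : ℝ)) (P.L - 1) K (M2 P K₀)
      (boxField K K₀ j σ A) i = derivA (dd P) (flowC C) 1 (P.L - 1) K (M2 P K₀) (constBond A₀' Subtype.val + A') i := by
    intro i; rw [derivA_smul, hfield]
  have hθ1' : 1 + ellC C * θ ≤ 1 + ellC C := by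
    have := mul_le_of_le_one_right hℓ₁ hθ1; linarith
  -- (2.17), derivative member, read on the torus bond `⟨x, x + εe_μ⟩ ⊂ □_j`
  intro ψ x μ hxc hsc
  set Φ := mulH (hBox ((P.L - 1 + 1) ^ K) K₀ (M2 P K₀) (fun _ => 1)) *ᵥ pull K K₀ j ψ with hΦ
  set u := propagatorK C (cube K K₀ j) (cubeVec K K₀ j A) msq a K (hTor K K₀ j • ψ) with hu_def
  have hu : pull K K₀ j u = P.mesh K ^ 2 • (greenA (dd P) (flowC C) (ec / (((P.L - 1 + 1) ^ K : ℕ) : ℝ)) (P.L - 1) K a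
      (msq * P.mesh K ^ 2) (M2 P K₀) (baseEmb (one_le_n P K) (M2 P K₀)) (gammaT P K K₀) (boxField K K₀ j σ A) *ᵥ Φ) := by
    rw [hu_def, pull_propagatorK C hK hK1 hK₀ hK₀8 hN3 hL2 j hκσ ha' hmsq A, pull_hsmul_hTor hK hK₀ hK₀' j ψ]
  -- the chart point of the bond
  set z : Fin (dd P + 1) → ℤ := fromT K K₀ j x with hz_def
  have hz : z ∈ Box (dd P) (P.L - 1) K (M2 P K₀) := (mem_cube_iff hK hK₀ hK₀' j x).1 hxc
  have hxz : toT K K₀ j z = x := toT_fromT j x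
  set i : Fin (dd P + 1) := (castD P).symm μ with hi_def
  have hμ : castD P i = μ := Equiv.apply_symm_apply _ _
  have hh2 : 2 ≤ half P K K₀ := two_le_half hK₀8
  have hz' : z + e1 i ∈ Box (dd P) (P.L - 1) K (M2 P K₀) :=
    (add_e1_mem_box_iff hK hK₀ hK₀' hN3 hh2 j hz i).2 (by rw [hxz, hμ]; exact hsc)
  have key := smul_ofLp_covDeriv_toT C hK hK₀ hK₀' j hκσ A u ⟨z, hz⟩ i hz'
  simp only at key
  rw [hxz, hμ, hu, Matrix.mulVec_smul, hconvD i, hconvG] at key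
  -- Lemma 2.2 (2.17), derivative member, on the box
  have main := ((hLγ K hK1 a _ e1' e2 hm2 e4 (M2 P K₀) hM (baseEmb (one_le_n P K) (M2 P K₀)) (gammaT P K K₀) hend'
    A₀' A' θ θ' (((dd P : ℝ) + 1) * θ) hunit hθ0 hA' hθ'0 hder hbd hτ0 hτ hsmγ Φ).2 i).trans
    (mul_le_mul_of_nonneg_right (mul_le_mul_of_nonneg_right hθ1' (by positivity)) (supN_nonneg _))
  -- sizes
  have hΦψ : supN Φ ≤ ‖ψ‖ := (supN_mulH_le hHS.abs_le _).trans (supN_pull_le j ψ)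
  have hsite := le_supN (P.mesh K ^ 2 • (derivA (dd P) (flowC C) 1 (P.L - 1) K (M2 P K₀) (constBond A₀' Subtype.val + A') i
    *ᵥ (greenA (dd P) (flowC C) 1 (P.L - 1) K a (msq * P.mesh K ^ 2) (M2 P K₀) (baseEmb (one_le_n P K) (M2 P K₀))
      (gammaT P K K₀) (constBond A₀' Subtype.val + A') *ᵥ Φ))) ⟨z, hz⟩
  rw [← key] at hsite
  have hsn : siteNorm (P.mesh K • WithLp.ofLp (covDeriv C (cubeVec K K₀ j A) u ⟨x, μ⟩))
      = P.mesh K * ‖covDeriv C (cubeVec K K₀ j A) u ⟨x, μ⟩‖ := by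
    rw [siteNorm_smul, abs_of_pos hmeshK, siteNorm_ofLp]
  rw [hsn] at hsite
  have hsup := (supN_smul_le (P.mesh K ^ 2) (derivA (dd P) (flowC C) 1 (P.L - 1) K (M2 P K₀) (constBond A₀' Subtype.val + A') i
    *ᵥ (greenA (dd P) (flowC C) 1 (P.L - 1) K a (msq * P.mesh K ^ 2) (M2 P K₀) (baseEmb (one_le_n P K) (M2 P K₀))
      (gammaT P K K₀) (constBond A₀' Subtype.val + A') *ᵥ Φ))).trans
    (mul_le_mul_of_nonneg_left (main.trans (mul_le_mul_of_nonneg_left hΦψ (by positivity))) (abs_nonneg _))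
  rw [abs_of_pos (by positivity)] at hsup
  -- `mesh·‖D u‖ ≤ mesh²·(1+ℓ₁)·2(d+2)c'·‖ψ‖`
  have hfin : P.mesh K * ‖covDeriv C (cubeVec K K₀ j A) u ⟨x, μ⟩‖ ≤ P.mesh K * (Cδ * P.mesh K * ‖ψ‖) := by
    refine (hsite.trans hsup).trans (le_of_eq ?_)
    rw [hCδ_def]; ring
  exact le_of_mul_le_mul_left hfin hmeshK

end Inputs

end Literature.MathematicalPhysics.QuantumFieldTheory.Balaban1983to89.B1TorusCubeDerivInput
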